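import Mathlib
import HarnessLib
import Summits.PneNP.PneNP.Theorems.CnfIdealGenLengthRankDefectRepresentationsTwoFamilyStability

/-!
# Finite rank-stability of `n` almost-commuting idempotents, for every `n` (line rank-dehn-ladder, stub `stub_finiteStability`)

Crux `stmt-PneNP-18923` (`Summit.PneNP.PneNP.Theses.CnfIdealGenLength.RankDefectRepresentations`), line
`rank-dehn-ladder`, NEGATIVE side, calibration rung N(−1) registered by lead g6 (RESHAPE 3 of
`Cruxes/RankDefectRepresentations/Lines/rank_dehn_ladder.lean`):

* `stub_finiteStability` — for every `n` there is a constant `C` (depending on `n` only) such that idempotent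
  matrices `E_1, …, E_n` over a field of characteristic `0` with pairwise commutator ranks `≤ t` are within
  coordinatewise rank `C · t` of a tuple of pairwise COMMUTING idempotents.

This is the generator form of the rank-stability of the elementary abelian group `Z_2^n`
[Bauer–Blachar–Greenfeld, IMRN 2025 = arXiv:2401.04676, Thm 5.1; bib BauerBlacharGreenfeld2025] — so far only cited on this line.  Proof: induction on `n`.
The cells `p_T = ∏_{i∈T} E′_i · ∏_{i∉T} (1 − E′_i)` of the already-genuine `E′_1, …, E′_n` form an exact complete
orthogonal family (`exists_cells`; the identities are proved for commuting idempotents of any commutative ring and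
transported from `Algebra.adjoin K (range E′)`) with `rank [X, p_T] ≤ ∑_i rank [X, E′_i]` (Leibniz); the landed
two-family step `…TwoFamilyStability.twoFamily_stable` (p614956; re-indexed to an arbitrary finite index type in
`twoFamily_stable_fintype`) applied to the family `(1 − E_{n+1}, E_{n+1})` against the cells yields an exact idempotent
commuting with every cell, hence with every `E′_i = ∑_{T ∋ i} p_T`.  Constant: `C_{n+1} = 90 · 2^n · (n+1) · (1 + 2 C_n)`.
The constant is not optimised (the known modulus is `2^{O(n)} · t`); what matters for the line is that
`C_n := sup dist/t` is FINITE for each `n`, so that rung 1 (`C_n / n` unbounded), rung 2 (`C_n` superpolynomial) and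
`stub_uniformStability` (`C_n ≤ n^a`) are statements about one kernel-checked quantity.
HONEST FRAMING: elementary linear algebra, a calibration rung; it settles nothing about the crux; P ≠ NP is not moved;
F-N2 is a FRONTIER formal rung.
-/

set_option linter.dupNamespace false -- `Summit.PneNP.PneNP.…`: summit = sub-problem name (D-0017)

namespace Summit.PneNP.PneNP.Theorems.CnfIdealGenLengthRankDefectRepresentationsFiniteStability

open Finset
open Literature.Computability.AlgebraicComplexity (rank_add_le rank_sum_le)
open Summit.PneNP.PneNP.Theorems.CnfIdealGenLengthRankDefectRepresentationsTseitinTransfer (rk_neg)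
open Summit.PneNP.PneNP.Theorems.CnfIdealGenLengthRankDefectRepresentationsTwoFamilyStability (twoFamily_stable)

/-! ## Cells of commuting idempotents in a commutative ring -/

section Commutative

variable {S : Type*} [CommRing S] {n : ℕ}

/-- The `2^n` cells `∏_{i∈T} e_i · ∏_{i∉T} (1 - e_i)` of any family `e` sum to `1` (expand `∏ (e_i + (1 - e_i))`).
(Same statement as `…CnfIdealGenLength.sum_pointIndicator_eq_one`, re-proved here to keep this file route-independent.)
[folklore] -/
theorem sum_cells_eq_one (e : Fin n → S) :
    ∑ T : Finset (Fin n), (∏ i ∈ T, e i) * ∏ i ∈ Tᶜ, (1 - e i) = 1 := by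
  have h := Finset.prod_add (fun i => e i) (fun i => 1 - e i) (Finset.univ : Finset (Fin n))
  simp only [add_sub_cancel, Finset.prod_const_one, Finset.powerset_univ] at h
  calc ∑ T : Finset (Fin n), (∏ i ∈ T, e i) * ∏ i ∈ Tᶜ, (1 - e i)
      = ∑ T : Finset (Fin n), (∏ i ∈ T, e i) * ∏ i ∈ Finset.univ \ T, (1 - e i) :=
        Finset.sum_congr rfl fun T _ => by rw [Finset.compl_eq_univ_sdiff]
    _ = 1 := h.symm

/-- A cell absorbs a generator it contains and is killed by one it does not. [folklore] -/
theorem cell_mul_gen (e : Fin n → S) (he : ∀ i, e i * e i = e i) (T : Finset (Fin n)) (j : Fin n) :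
    ((∏ i ∈ T, e i) * ∏ i ∈ Tᶜ, (1 - e i)) * e j =
      if j ∈ T then (∏ i ∈ T, e i) * ∏ i ∈ Tᶜ, (1 - e i) else 0 := by
  by_cases hj : j ∈ T
  · rw [if_pos hj]
    have hsplit := Finset.mul_prod_erase T e hj
    rw [← hsplit]
    calc e j * (∏ x ∈ T.erase j, e x) * (∏ i ∈ Tᶜ, (1 - e i)) * e j
        = (e j * e j) * (∏ x ∈ T.erase j, e x) * ∏ i ∈ Tᶜ, (1 - e i) := by ring
      _ = _ := by rw [he]
  · rw [if_neg hj]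
    have hj' : j ∈ Tᶜ := Finset.mem_compl.2 hj
    have hsplit := Finset.mul_prod_erase Tᶜ (fun i => 1 - e i) hj'
    rw [← hsplit]
    calc (∏ i ∈ T, e i) * ((1 - e j) * ∏ x ∈ Tᶜ.erase j, (1 - e x)) * e j
        = (e j - e j * e j) * ((∏ i ∈ T, e i) * ∏ x ∈ Tᶜ.erase j, (1 - e x)) := by ring
      _ = 0 := by rw [he, sub_self, zero_mul]

/-- A cell is killed by the complement of a generator it contains and absorbs the others. [folklore] -/
theorem cell_mul_compl (e : Fin n → S) (he : ∀ i, e i * e i = e i) (T : Finset (Fin n)) (j : Fin n) :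
    ((∏ i ∈ T, e i) * ∏ i ∈ Tᶜ, (1 - e i)) * (1 - e j) =
      if j ∈ T then 0 else (∏ i ∈ T, e i) * ∏ i ∈ Tᶜ, (1 - e i) := by
  rw [mul_sub, mul_one, cell_mul_gen e he]
  split_ifs <;> simp

/-- A cell absorbs every finite product of factors it absorbs. [folklore] -/
theorem cell_absorb (c : S) (A : Finset (Fin n)) (f : Fin n → S) (hf : ∀ i ∈ A, c * f i = c) :
    c * ∏ i ∈ A, f i = c := by
  classical
  induction A using Finset.induction_on with
  | empty => simp
  | insert a A ha ih =>
    rw [Finset.prod_insert ha, ← mul_assoc, hf a (Finset.mem_insert_self a A)]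
    exact ih fun i hi => hf i (Finset.mem_insert_of_mem hi)

/-- Cells are idempotent. [folklore] -/
theorem cell_mul_self (e : Fin n → S) (he : ∀ i, e i * e i = e i) (T : Finset (Fin n)) :
    ((∏ i ∈ T, e i) * ∏ i ∈ Tᶜ, (1 - e i)) * ((∏ i ∈ T, e i) * ∏ i ∈ Tᶜ, (1 - e i)) =
      (∏ i ∈ T, e i) * ∏ i ∈ Tᶜ, (1 - e i) := by
  have h1 : ((∏ i ∈ T, e i) * ∏ i ∈ Tᶜ, (1 - e i)) * ∏ i ∈ T, e i = (∏ i ∈ T, e i) * ∏ i ∈ Tᶜ, (1 - e i) :=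
    cell_absorb _ T e fun i hi => by rw [cell_mul_gen e he, if_pos hi]
  have h2 : ((∏ i ∈ T, e i) * ∏ i ∈ Tᶜ, (1 - e i)) * ∏ i ∈ Tᶜ, (1 - e i) =
      (∏ i ∈ T, e i) * ∏ i ∈ Tᶜ, (1 - e i) :=
    cell_absorb _ Tᶜ (fun i => 1 - e i) fun i hi => by
      rw [cell_mul_compl e he, if_neg (Finset.mem_compl.1 hi)]
  rw [← mul_assoc, h1, h2]

/-- Distinct cells are orthogonal. [folklore] -/
theorem cell_mul_cell_of_ne (e : Fin n → S) (he : ∀ i, e i * e i = e i) {T U : Finset (Fin n)} (hTU : T ≠ U) :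
    ((∏ i ∈ T, e i) * ∏ i ∈ Tᶜ, (1 - e i)) * ((∏ i ∈ U, e i) * ∏ i ∈ Uᶜ, (1 - e i)) = 0 := by
  obtain ⟨j, hj⟩ : ∃ j, ¬ (j ∈ T ↔ j ∈ U) := by
    by_contra hall
    push Not at hall
    exact hTU (Finset.ext hall)
  set pT := (∏ i ∈ T, e i) * ∏ i ∈ Tᶜ, (1 - e i) with hpT
  set pU := (∏ i ∈ U, e i) * ∏ i ∈ Uᶜ, (1 - e i) with hpU
  have hT := cell_mul_gen e he T j
  have hU := cell_mul_gen e he U j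
  rw [← hpT] at hT
  rw [← hpU] at hU
  by_cases hjT : j ∈ T
  · have hjU : j ∉ U := fun h => hj ⟨fun _ => h, fun _ => hjT⟩
    rw [if_pos hjT] at hT
    rw [if_neg hjU] at hU
    calc pT * pU = (pT * e j) * pU := by rw [hT]
      _ = pT * (pU * e j) := by ring
      _ = 0 := by rw [hU, mul_zero]
  · have hjU : j ∈ U := by
      by_contra h
      exact hj ⟨fun h' => absurd h' hjT, fun h' => absurd h' h⟩
    rw [if_neg hjT] at hT
    rw [if_pos hjU] at hU
    calc pT * pU = pT * (pU * e j) := by rw [hU]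
      _ = (pT * e j) * pU := by ring
      _ = 0 := by rw [hT, zero_mul]

/-- Each generator is the sum of the cells containing it. [folklore] -/
theorem gen_eq_sum_cells (e : Fin n → S) (he : ∀ i, e i * e i = e i) (j : Fin n) :
    e j = ∑ T ∈ Finset.univ.filter (fun T : Finset (Fin n) => j ∈ T), (∏ i ∈ T, e i) * ∏ i ∈ Tᶜ, (1 - e i) := by
  classical
  rw [Finset.sum_filter]
  calc e j = (∑ T : Finset (Fin n), (∏ i ∈ T, e i) * ∏ i ∈ Tᶜ, (1 - e i)) * e j := by
          rw [sum_cells_eq_one e, one_mul]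
    _ = ∑ T : Finset (Fin n), ((∏ i ∈ T, e i) * ∏ i ∈ Tᶜ, (1 - e i)) * e j := Finset.sum_mul _ _ _
    _ = _ := Finset.sum_congr rfl fun T _ => cell_mul_gen e he T j

end Commutative

/-! ## Leibniz: commutator rank along a product -/

section Leibniz

variable {K : Type} [Field K] {d : ℕ} {S : Type*} [CommRing S] {n : ℕ}

/-- `rank [X, φ(ab)] ≤ rank [X, φ a] + rank [X, φ b]` for a multiplicative `φ`. [folklore] -/
theorem rank_comm_mul_le (φ : S → Matrix (Fin d) (Fin d) K) (hφ : ∀ a b, φ (a * b) = φ a * φ b)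
    (X : Matrix (Fin d) (Fin d) K) (a b : S) :
    (X * φ (a * b) - φ (a * b) * X).rank ≤ (X * φ a - φ a * X).rank + (X * φ b - φ b * X).rank := by
  rw [hφ]
  have e1 : X * (φ a * φ b) - φ a * φ b * X = (X * φ a - φ a * X) * φ b + φ a * (X * φ b - φ b * X) := by
    noncomm_ring
  rw [e1]
  exact (rank_add_le _ _).trans (Nat.add_le_add (Matrix.rank_mul_le_left _ _) (Matrix.rank_mul_le_right _ _))

/-- Leibniz along a finite product. [folklore] -/
theorem rank_comm_prod_le (φ : S → Matrix (Fin d) (Fin d) K) (hφ : ∀ a b, φ (a * b) = φ a * φ b)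
    (hφ1 : φ 1 = 1) (X : Matrix (Fin d) (Fin d) K) (A : Finset (Fin n)) (f : Fin n → S) :
    (X * φ (∏ i ∈ A, f i) - φ (∏ i ∈ A, f i) * X).rank ≤ ∑ i ∈ A, (X * φ (f i) - φ (f i) * X).rank := by
  classical
  induction A using Finset.induction_on with
  | empty => simp [hφ1]
  | insert a A ha ih =>
    rw [Finset.prod_insert ha, Finset.sum_insert ha]
    exact (rank_comm_mul_le φ hφ X (f a) _).trans (Nat.add_le_add_left ih _)

/-- The commutator rank with `φ (1 - a)` equals that with `φ a`. [folklore] -/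
theorem rank_comm_one_sub (φ : S → Matrix (Fin d) (Fin d) K) (hφ1 : φ 1 = 1)
    (hφs : ∀ a b, φ (a - b) = φ a - φ b) (X : Matrix (Fin d) (Fin d) K) (a : S) :
    (X * φ (1 - a) - φ (1 - a) * X).rank = (X * φ a - φ a * X).rank := by
  rw [hφs, hφ1]
  have e1 : X * (1 - φ a) - (1 - φ a) * X = -(X * φ a - φ a * X) := by noncomm_ring
  rw [e1, rk_neg]

/-- Leibniz for a cell: `rank [X, φ(p_T)] ≤ ∑_i rank [X, φ(e_i)]`. [folklore] -/
theorem rank_comm_cell_le (φ : S → Matrix (Fin d) (Fin d) K) (hφ : ∀ a b, φ (a * b) = φ a * φ b)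
    (hφ1 : φ 1 = 1) (hφs : ∀ a b, φ (a - b) = φ a - φ b) (X : Matrix (Fin d) (Fin d) K)
    (e : Fin n → S) (T : Finset (Fin n)) :
    (X * φ ((∏ i ∈ T, e i) * ∏ i ∈ Tᶜ, (1 - e i)) - φ ((∏ i ∈ T, e i) * ∏ i ∈ Tᶜ, (1 - e i)) * X).rank ≤
      ∑ i, (X * φ (e i) - φ (e i) * X).rank := by
  calc (X * φ ((∏ i ∈ T, e i) * ∏ i ∈ Tᶜ, (1 - e i)) - φ ((∏ i ∈ T, e i) * ∏ i ∈ Tᶜ, (1 - e i)) * X).rank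
      ≤ (X * φ (∏ i ∈ T, e i) - φ (∏ i ∈ T, e i) * X).rank +
          (X * φ (∏ i ∈ Tᶜ, (1 - e i)) - φ (∏ i ∈ Tᶜ, (1 - e i)) * X).rank := rank_comm_mul_le φ hφ X _ _
    _ ≤ ∑ i ∈ T, (X * φ (e i) - φ (e i) * X).rank + ∑ i ∈ Tᶜ, (X * φ (1 - e i) - φ (1 - e i) * X).rank :=
        Nat.add_le_add (rank_comm_prod_le φ hφ hφ1 X T e) (rank_comm_prod_le φ hφ hφ1 X Tᶜ fun i => 1 - e i)
    _ = ∑ i ∈ T, (X * φ (e i) - φ (e i) * X).rank + ∑ i ∈ Tᶜ, (X * φ (e i) - φ (e i) * X).rank := by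
        congr 1
        exact Finset.sum_congr rfl fun i _ => rank_comm_one_sub φ hφ1 hφs X (e i)
    _ = ∑ i, (X * φ (e i) - φ (e i) * X).rank := Finset.sum_add_sum_compl T _

end Leibniz

variable {K : Type} [Field K] {d : ℕ}

/-! ## The two-family step over an arbitrary finite index type -/

/-- `twoFamily_stable` (p614956) with the exact family `P` indexed by any nonempty finite type. -/
theorem twoFamily_stable_fintype [CharZero K] {ι : Type} [Fintype ι] [Nonempty ι]
    (P : ι → Matrix (Fin d) (Fin d) K)
    (hP : ∀ k, P k * P k = P k) (hPorth : ∀ k l, k ≠ l → P k * P l = 0) (hPsum : ∑ k, P k = 1)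
    {b : ℕ} (R : Fin (b + 1) → Matrix (Fin d) (Fin d) K)
    (hR : ∀ l, R l * R l = R l) (hRorth : ∀ l m, l ≠ m → R l * R m = 0) (hRsum : ∑ l, R l = 1) (s : ℕ)
    (hcomm : ∀ l, ∑ k, (R l * P k - P k * R l).rank ≤ s) :
    ∃ R' : Fin (b + 1) → Matrix (Fin d) (Fin d) K,
      (∀ l, R' l * R' l = R' l) ∧ (∀ l m, l ≠ m → R' l * R' m = 0) ∧ (∑ l, R' l = 1) ∧
      (∀ k l, P k * R' l = R' l * P k) ∧ ∀ l, (R' l - R l).rank ≤ 10 * (b + 2) ^ 2 * s := by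
  classical
  obtain ⟨a, ha⟩ : ∃ a, Fintype.card ι = a + 1 := Nat.exists_eq_succ_of_ne_zero Fintype.card_ne_zero
  let e : ι ≃ Fin (a + 1) := (Fintype.equivFin ι).trans (finCongr ha)
  have hsum' : ∑ k, P (e.symm k) = 1 := by
    rw [← hPsum]; exact e.symm.sum_comp P
  have hcomm' : ∀ l, ∑ k, (R l * P (e.symm k) - P (e.symm k) * R l).rank ≤ s := by
    intro l
    rw [e.symm.sum_comp (fun i => (R l * P i - P i * R l).rank)]
    exact hcomm l
  obtain ⟨R', h1, h2, h3, h4, h5⟩ := twoFamily_stable (fun k => P (e.symm k)) (fun k => hP _)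
    (fun k l hkl => hPorth _ _ (e.symm.injective.ne hkl)) hsum' R hR hRorth hRsum s hcomm'
  refine ⟨R', h1, h2, h3, fun i l => ?_, h5⟩
  have := h4 (e i) l
  simpa using this

/-! ## Cells of a commuting idempotent matrix family -/

/-- **Cells.** A pairwise commuting family of idempotent matrices `E′_1, …, E′_n` has an exact complete orthogonal
family of `2^n` cells `p_T` (`T ⊆ [n]`) with `E′_i = ∑_{T ∋ i} p_T`, and `rank [X, p_T] ≤ ∑_i rank [X, E′_i]` for every
matrix `X`. [folklore] -/
theorem exists_cells {n : ℕ} (E' : Fin n → Matrix (Fin d) (Fin d) K)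
    (h1 : ∀ i, E' i * E' i = E' i) (h2 : ∀ i j, E' i * E' j = E' j * E' i) :
    ∃ Pc : Finset (Fin n) → Matrix (Fin d) (Fin d) K,
      (∀ T, Pc T * Pc T = Pc T) ∧ (∀ T U, T ≠ U → Pc T * Pc U = 0) ∧ (∑ T, Pc T = 1) ∧
      (∀ i, E' i = ∑ T ∈ Finset.univ.filter (fun T => i ∈ T), Pc T) ∧
      (∀ (X : Matrix (Fin d) (Fin d) K) (T : Finset (Fin n)),
        (X * Pc T - Pc T * X).rank ≤ ∑ i, (X * E' i - E' i * X).rank) := by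
  classical
  have hc : IsMulCommutative (Algebra.adjoin K (Set.range E')) :=
    Algebra.isMulCommutative_adjoin K (by rintro _ ⟨i, rfl⟩ _ ⟨j, rfl⟩; exact h2 i j)
  letI : CommRing (Algebra.adjoin K (Set.range E')) :=
    { (inferInstance : Ring (Algebra.adjoin K (Set.range E'))) with mul_comm := hc.is_comm.comm }
  set e : Fin n → Algebra.adjoin K (Set.range E') :=
    fun i => ⟨E' i, Algebra.subset_adjoin (Set.mem_range_self i)⟩ with he_def
  have he : ∀ i, e i * e i = e i := fun i => Subtype.ext (h1 i)
  let φ : Algebra.adjoin K (Set.range E') → Matrix (Fin d) (Fin d) K := fun s => (Algebra.adjoin K (Set.range E')).val s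
  have hφ : ∀ a b, φ (a * b) = φ a * φ b := fun a b => map_mul _ a b
  have hφ1 : φ 1 = 1 := map_one _
  have hφ0 : φ 0 = 0 := map_zero _
  have hφs : ∀ a b, φ (a - b) = φ a - φ b := fun a b => map_sub _ a b
  have hφsum : ∀ (s : Finset (Finset (Fin n))) (f : Finset (Fin n) → Algebra.adjoin K (Set.range E')),
      φ (∑ T ∈ s, f T) = ∑ T ∈ s, φ (f T) := fun s f => map_sum _ f s
  have hφe : ∀ i, φ (e i) = E' i := fun i => rfl
  refine ⟨fun T => φ ((∏ i ∈ T, e i) * ∏ i ∈ Tᶜ, (1 - e i)), fun T => ?_, fun T U hTU => ?_, ?_, fun i => ?_,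
    fun X T => ?_⟩
  · rw [← hφ, cell_mul_self e he]
  · rw [← hφ, cell_mul_cell_of_ne e he hTU, hφ0]
  · rw [← hφsum, sum_cells_eq_one e, hφ1]
  · rw [← hφsum, ← gen_eq_sum_cells e he i]
    exact (hφe i).symm
  · have h := rank_comm_cell_le φ hφ hφ1 hφs X e T
    simpa only [hφe] using h

/-! ## The stub -/

/-- STUB `stub_finiteStability` of the line `rank-dehn-ladder` (registered signature, verbatim): for every `n` a
finite constant `C` such that idempotent matrices `E_1, …, E_n` (char 0) with pairwise commutator ranks `≤ t` are
within coordinatewise rank `C · t` of a pairwise commuting idempotent tuple.  Induction on `n` over the cells of the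
already-genuine prefix and the two-family step. [cite: BauerBlacharGreenfeld2025, Thm 5.1 (rank-stability of finite groups; here the generator form for `Z_2^n`,
self-contained proof)] -/
theorem stub_finiteStability :
    ∀ n : ℕ, ∃ C : ℕ, ∀ (K : Type) [Field K] [CharZero K] (d t : ℕ) (E : Fin n → Matrix (Fin d) (Fin d) K),
      (∀ i, E i * E i = E i) → (∀ i j, (E i * E j - E j * E i).rank ≤ t) →
      ∃ E' : Fin n → Matrix (Fin d) (Fin d) K, (∀ i, E' i * E' i = E' i) ∧ (∀ i j, E' i * E' j = E' j * E' i) ∧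
        ∀ i, (E i - E' i).rank ≤ C * t := by
  intro n
  induction n with
  | zero =>
    exact ⟨0, fun K _ _ d t E _ _ => ⟨E, fun i => i.elim0, fun i => i.elim0, fun i => i.elim0⟩⟩
  | succ n ih =>
    obtain ⟨C, hC⟩ := ih
    refine ⟨90 * 2 ^ n * (n + 1) * (1 + 2 * C), fun K _ _ d t E hE hcomm => ?_⟩
    classical
    -- Step 1: the prefix `E_1..E_n` is within `C·t` of a genuine tuple `E'`
    obtain ⟨E', hE'1, hE'2, hdist⟩ :=
      hC K d t (fun i => E i.castSucc) (fun i => hE _) (fun i j => hcomm _ _)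
    set X : Matrix (Fin d) (Fin d) K := E (Fin.last n) with hX_def
    have hX : X * X = X := hE _
    -- Step 2: commutators of the last idempotent with the corrected prefix
    have hu : ∀ i, (X * E' i - E' i * X).rank ≤ (1 + 2 * C) * t := by
      intro i
      have e1 : X * E' i - E' i * X =
          (X * E i.castSucc - E i.castSucc * X) + ((E i.castSucc - E' i) * X + -(X * (E i.castSucc - E' i))) := by
        noncomm_ring
      rw [e1]
      refine (rank_add_le _ _).trans ?_
      have r1 : (X * E i.castSucc - E i.castSucc * X).rank ≤ t := hcomm _ _
      have r2 : ((E i.castSucc - E' i) * X + -(X * (E i.castSucc - E' i))).rank ≤ C * t + C * t := by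
        refine (rank_add_le _ _).trans (Nat.add_le_add ?_ ?_)
        · exact (Matrix.rank_mul_le_left _ _).trans (hdist i)
        · rw [rk_neg]; exact (Matrix.rank_mul_le_right _ _).trans (hdist i)
      have : t + (C * t + C * t) = (1 + 2 * C) * t := by ring
      rw [← this]
      exact Nat.add_le_add r1 r2
    -- Step 3: cells of the genuine prefix
    obtain ⟨Pc, hPc1, hPc2, hPc3, hPcE, hPccomm⟩ := exists_cells E' hE'1 hE'2
    have hcell : ∀ T, (X * Pc T - Pc T * X).rank ≤ n * ((1 + 2 * C) * t) := by
      intro T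
      refine (hPccomm X T).trans ?_
      have := Finset.sum_le_card_nsmul (Finset.univ : Finset (Fin n)) (fun i => (X * E' i - E' i * X).rank)
        ((1 + 2 * C) * t) (fun i _ => hu i)
      simpa using this
    -- Step 4: the two-family step for `(1 - X, X)` against the cells
    set R : Fin 2 → Matrix (Fin d) (Fin d) K := ![1 - X, X] with hR_def
    have hR0 : R 0 = 1 - X := rfl
    have hR1 : R 1 = X := rfl
    have hRid : ∀ l, R l * R l = R l := by
      intro l
      fin_cases l
      · show (1 - X) * (1 - X) = 1 - X
        have e1 : (1 - X) * (1 - X) = 1 - X - (X - X * X) := by noncomm_ring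
        rw [e1, hX, sub_self, sub_zero]
      · exact hX
    have hRorth : ∀ l m, l ≠ m → R l * R m = 0 := by
      intro l m hlm
      fin_cases l <;> fin_cases m
      · exact absurd rfl hlm
      · show (1 - X) * X = 0
        rw [sub_mul, one_mul, hX, sub_self]
      · show X * (1 - X) = 0
        rw [mul_sub, mul_one, hX, sub_self]
      · exact absurd rfl hlm
    have hRsum : ∑ l, R l = 1 := by
      rw [Fin.sum_univ_two, hR0, hR1, sub_add_cancel]
    set s : ℕ := 2 ^ n * (n * ((1 + 2 * C) * t)) with hs_def
    have key : ∑ T : Finset (Fin n), (X * Pc T - Pc T * X).rank ≤ s := by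
      have := Finset.sum_le_card_nsmul (Finset.univ : Finset (Finset (Fin n)))
        (fun T => (X * Pc T - Pc T * X).rank) (n * ((1 + 2 * C) * t)) (fun T _ => hcell T)
      simpa [Fintype.card_finset] using this
    have hRcomm : ∀ l, ∑ T, (R l * Pc T - Pc T * R l).rank ≤ s := by
      intro l
      fin_cases l
      · refine le_trans (le_of_eq (Finset.sum_congr rfl fun T _ => ?_)) key
        show ((1 - X) * Pc T - Pc T * (1 - X)).rank = (X * Pc T - Pc T * X).rank
        have e1 : (1 - X) * Pc T - Pc T * (1 - X) = -(X * Pc T - Pc T * X) := by noncomm_ring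
        rw [e1, rk_neg]
      · exact key
    obtain ⟨R', hR'1, -, -, hR'comm, hR'dist⟩ :=
      twoFamily_stable_fintype Pc hPc1 hPc2 hPc3 R hRid hRorth hRsum s hRcomm
    -- Step 5: the corrected last idempotent commutes with the prefix
    set X' : Matrix (Fin d) (Fin d) K := R' 1 with hX'_def
    have hX'E : ∀ i, E' i * X' = X' * E' i := by
      intro i
      rw [hPcE i, Finset.sum_mul, Finset.mul_sum]
      exact Finset.sum_congr rfl fun T _ => hR'comm T 1
    have hX'dist : (X - X').rank ≤ 90 * 2 ^ n * (n + 1) * (1 + 2 * C) * t := by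
      rw [← rk_neg, neg_sub]
      refine (hR'dist 1).trans ?_
      have e1 : 10 * (1 + 2) ^ 2 * s = 90 * 2 ^ n * n * (1 + 2 * C) * t := by rw [hs_def]; ring
      rw [e1]
      have : n ≤ n + 1 := Nat.le_succ n
      gcongr
    have hCle : C * t ≤ 90 * 2 ^ n * (n + 1) * (1 + 2 * C) * t := by
      refine Nat.mul_le_mul_right t ?_
      have h1 : 1 ≤ 2 ^ n := Nat.one_le_two_pow
      calc C ≤ 1 * 1 * 1 * (1 + 2 * C) := by omega
        _ ≤ 90 * 2 ^ n * (n + 1) * (1 + 2 * C) := by gcongr <;> omega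
    -- Step 6: assemble
    refine ⟨Fin.snoc E' X', fun i => ?_, fun i j => ?_, fun i => ?_⟩
    · induction i using Fin.lastCases with
      | last => rw [Fin.snoc_last]; exact hR'1 1
      | cast i => rw [Fin.snoc_castSucc]; exact hE'1 i
    · induction i using Fin.lastCases with
      | last =>
        induction j using Fin.lastCases with
        | last => rfl
        | cast j => rw [Fin.snoc_last, Fin.snoc_castSucc]; exact (hX'E j).symm
      | cast i =>
        induction j using Fin.lastCases with
        | last => rw [Fin.snoc_last, Fin.snoc_castSucc]; exact hX'E i
        | cast j => rw [Fin.snoc_castSucc, Fin.snoc_castSucc]; exact hE'2 i j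
    · induction i using Fin.lastCases with
      | last => rw [Fin.snoc_last]; exact hX'dist
      | cast i => rw [Fin.snoc_castSucc]; exact (hdist i).trans hCle

end Summit.PneNP.PneNP.Theorems.CnfIdealGenLengthRankDefectRepresentationsFiniteStability
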